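/-
Copyright (c) 2026 the pub-hodgecm-mathlib formalisation cell (harness21).  Prover seat hodgecm-mathlib-LH4-p04 (g3), req620 Track A «(D-RAM) FOUR-FRAME» squad
(unit U2H_HSide, the (ρ2b′-X) payer road (payer lineage LH4-p14, HEAD-OF-ORGANS MAP v1 seam S7 «T5s re-cut owed: top bit + 2n_H = jl»); letters of record = LH4-p08 (g4)
T5a sheet v5 (DIFF DONE 04:43Z against LH4-r01 (g5)'s d ∈ {4,5} PER tables); dealer∕pen LH4-plan (g12) WORD #21∕#22; heir LEAD F0P3a-plan (g20) T19-01 (5)(a) ∕ T19-02 (R-25)).  2026-09-04.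
-/
import Summits.HodgeConjecture.HodgeConjecture.Theorems.F0P3cDyRamToricCensusSumUnrV5Parts   -- FILE 1 (this seat): `colP_eval_v5`, `rowM_eval_v5`, `sumP_eval_v5`, `sumM_eval_v5`; brings ★ p857321∕p857337 tools
import HarnessLib

/-!
# Crux `H413`, line LH4 «(D-RAM) FOUR-FRAME» road — unit U2H (ii-H), the (ρ2b′-X) payer: O-Sum ∕ T5s «TORIC CENSUS SUM», TYPE U, SHEET-v5 LETTERS — FILE 2∕2 «THE IDENTITY»:
# `ε·Σ_{j ≤ jl} Σ_a q^a (dep₊(j,a) − dep₋(j,a)) = q^m·(N_V(jl∕2) − 2[S]_q)` on the realizable token set with `S − 1 ≤ m`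

Cell `hodgecm-mathlib` (D-0151), FLOOR 0, crux item H413 = `stmt-HodgeConjecture-24833`, route of record `HCCMUnconditional`; squad F0∕P3c∕LH4 (req618∕req620); registered stub
served: `F0P3cDyRamFourFrameU2H.stub_U2H_fixedPointCensus_typeTwo_unit0` ((ρ2b′-X), tree `Cruxes/H413/Lines/F0_P3c_DyRamFourFrame_U2H_HSide.lean` ED. 15 :418), organ O-Sum ∕
T5s (payer lineage LH4-p14, HEAD-OF-ORGANS MAP v1 seam S7), type U = `K∕F` unramified.  THEOREMS ONLY (no `def`, no instance, no notation, no `sorry`, default heartbeats); lane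
`--supports stmt-HodgeConjecture-24833 --as helper` (count-neutral).

THE STATEMENT (HEAD BYTES v3 posted first 04:51Z, 7b109cc1692b63fd; validated `validate_head.v3` 5a5d4b92b2e6dded: hreal ∩ {S − 1 ≤ m}, 524∕524 tuples q ≤ 5, 2 ≤ d ≤ 7,
jl ≤ 16): the seven cell families of ★ `…ToricCensusSumUnr` with EXACTLY LH4-p08 (g4)'s two sheet-v5 letters — TOP BITS `(d + m ≤ jl ∧ (jl − d − m) % 2 = 0) ∧ 2j + d ≤ 2jl + 1`
(`+`; the sheet's `∃ k, d + m + 2k = jl` spelled decidably) and `jl + 1 = d + m ∧ 2j + d ≤ 2jl + 1` (`−`) — the H-level binder `n_H = jl∕2`, and the token-side hypothesis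
`hmS : d − d % 2 ≤ m + 1` (`S − 1 ≤ m`; void at d ≤ 3) without which the identity is false inside `hreal` (e.g. `(q,d,jl,m,ε) = (2,4,6,2,+1)`).
PROOF = FILE 1 (`sumP_eval_v5` − `sumM_eval_v5`), `A0₊^{<d} − A0₋ = −q^{d−1}` (★ `alt_index_sum`), then `algebra_pos_v5` ∕ `algebra_neg_v5`: one multiplication by `q − 1`,
`d + L = jl∕2 + S∕2`, telescoping of the three `(q+1)`-blocks to `(q+1)(q^{m+jl∕2} − q^{d−1})`, `ring` in the atoms `q^L, q^{⌊m∕2⌋}, q^{S∕2−1}, q` per parity of `d`.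
HONEST LABEL.  Count-neutral (`--supports`); nothing printed is asserted; (ρ2b′-X) `stub_U2H_fixedPointCensus_typeTwo_unit0` (U2H :418) stays a PROVER TARGET (an empirical
census law, kit-confirmed; (R-25): organ road measured at `tE = 2`, `tE ≠ 2` a named open sub-case) until its payer lands; `HC_CM` is proved only modulo the 7 printed citations
(2 remaining named inputs: hLiu418 = `stmt-HodgeConjecture-24832`, h413 = `stmt-HodgeConjecture-24833`) until rung 0 closes.

## References
* [Kottwitz1986BaseChangeUnits] R. E. Kottwitz, *Base change for unit elements of Hecke algebras*, Compositio Math. 60 (1986), §1 pp. 240–241 (orbital integrals of units as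
  lattice counts modulo the torus).
* [Rogawski1990] J. D. Rogawski, *Automorphic Representations of Unitary Groups in Three Variables*, Ann. of Math. Stud. 123 (1990), §4.9 Prop. 4.9.1 (b) p. 55, Lemma 4.9.3 p. 56
  (the fixed-point census of a type-(2) element; the toric decomposition).
-/

set_option autoImplicit false

namespace Summit.HodgeConjecture.HodgeConjecture.Cruxes.H413.F0P3cDyRamToricCensusSumUnrV5

open Finset
open Summit.HodgeConjecture.HodgeConjecture.Cruxes.H413.F0P3cDyRamToricCensusSumUnrBlocks (sum_range_parity_reindex sum_range_window_reindex sum_range_ray_single geom_sum_mul' geom_sum_two_mul alt_index_sum)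
open Summit.HodgeConjecture.HodgeConjecture.Cruxes.H413.F0P3cDyRamToricCensusSumUnrParts (low_block_mul)
open Summit.HodgeConjecture.HodgeConjecture.Cruxes.H413.F0P3cDyRamToricCensusSumUnrV5Parts

/-- THE ARITHMETIC, `ε = +1` branch (`m ≡ d (mod 2)`, `S − 1 ≤ m`, `m ≤ jl − d`, `S = d − d%2`): after one multiplication by `x − 1` the `(x+1)`-blocks telescope to
`(x+1)(x^{m + jl∕2} − x^{d−1})` and everything collapses to `x^m((x+1)x^{jl∕2} − 2x^S)`; `ring` in the atoms `x^L, x^{⌊m∕2⌋}, x^{S∕2−1}, x` per parity of `d`. [folklore] -/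
theorem algebra_pos_v5 (x : ℚ) (hx1 : x ≠ 1) {d jl m : ℕ} (hd : 2 ≤ d) (hpar : m % 2 = d % 2) (hmS : d - d % 2 ≤ m + 1) (hmd : m + d ≤ jl) (hjl : jl % 2 = 0)
    (A0P A0M : ℚ) (hA0 : A0P - A0M = -x ^ (d - 1)) :
    (A0P + (x + 1) * x ^ (d - 1) * ∑ u ∈ range ((jl - d) / 2 + 1), x ^ u +
        ∑ i ∈ range (m / 2), (x ^ 2 - 1) * x ^ (2 * i + d) * ∑ u ∈ range ((jl - d) / 2 - i), x ^ u +
        (x + 1) * x ^ (m / 2 + 1 + (d + (jl - m - d) / 2 + m / 2 - 1)) * ∑ i ∈ range ((2 * m + 1 - d) / 2 - m / 2), x ^ i) -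
      (A0M + (x + 1) * x ^ d * ∑ i ∈ range (m / 2), x ^ (2 * i)) =
      x ^ m * ((1 + (x + 1) * ∑ i ∈ range (jl / 2), x ^ i) - 2 * ∑ i ∈ range (d - d % 2), x ^ i) := by
  set L := (jl - d) / 2 with hL
  set h := m / 2 with hh
  set p := (d - d % 2) / 2 - 1 with hp
  have hhL : h ≤ L := by omega
  apply mul_left_cancel₀ (sub_ne_zero.2 hx1)
  have t1 : (x - 1) * ((x + 1) * x ^ (d - 1) * ∑ u ∈ range (L + 1), x ^ u) = (x + 1) * x ^ (d - 1) * (x ^ L * x - 1) := by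
    rw [show (x - 1) * ((x + 1) * x ^ (d - 1) * ∑ u ∈ range (L + 1), x ^ u) = (x + 1) * x ^ (d - 1) * ((x - 1) * ∑ u ∈ range (L + 1), x ^ u) by ring,
      geom_sum_mul', pow_succ]
  have t2 := low_block_mul x (d := d) (L := L) (h := h) (by omega) hhL
  have t3 : (x - 1) * ((x + 1) * x ^ (h + 1 + (d + (jl - m - d) / 2 + h - 1)) * ∑ i ∈ range ((2 * m + 1 - d) / 2 - h), x ^ i) =
      (x + 1) * (x ^ (h + 1 + (d + (jl - m - d) / 2 + h - 1)) * x ^ ((2 * m + 1 - d) / 2 - h) - x ^ (h + 1 + (d + (jl - m - d) / 2 + h - 1))) := by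
    rw [show (x - 1) * ((x + 1) * x ^ (h + 1 + (d + (jl - m - d) / 2 + h - 1)) * ∑ i ∈ range ((2 * m + 1 - d) / 2 - h), x ^ i) =
      (x + 1) * x ^ (h + 1 + (d + (jl - m - d) / 2 + h - 1)) * ((x - 1) * ∑ i ∈ range ((2 * m + 1 - d) / 2 - h), x ^ i) by ring, geom_sum_mul']
    ring
  have t4 : (x - 1) * ((x + 1) * x ^ d * ∑ i ∈ range h, x ^ (2 * i)) = x ^ d * (x ^ (2 * h) - 1) := by
    rw [show (x - 1) * ((x + 1) * x ^ d * ∑ i ∈ range h, x ^ (2 * i)) = x ^ d * ((x ^ 2 - 1) * ∑ i ∈ range h, x ^ (2 * i)) by ring, geom_sum_two_mul]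
  have t5 : (x - 1) * (x ^ m * ((1 + (x + 1) * ∑ i ∈ range (jl / 2), x ^ i) - 2 * ∑ i ∈ range (d - d % 2), x ^ i)) =
      x ^ m * ((x - 1) + (x + 1) * (x ^ (jl / 2) - 1) - 2 * (x ^ (d - d % 2) - 1)) := by
    rw [show (x - 1) * (x ^ m * ((1 + (x + 1) * ∑ i ∈ range (jl / 2), x ^ i) - 2 * ∑ i ∈ range (d - d % 2), x ^ i)) =
      x ^ m * ((x - 1) + (x + 1) * ((x - 1) * ∑ i ∈ range (jl / 2), x ^ i) - 2 * ((x - 1) * ∑ i ∈ range (d - d % 2), x ^ i)) by ring,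
      geom_sum_mul', geom_sum_mul']
  rw [show (x - 1) * (A0P + (x + 1) * x ^ (d - 1) * ∑ u ∈ range (L + 1), x ^ u +
        ∑ i ∈ range h, (x ^ 2 - 1) * x ^ (2 * i + d) * ∑ u ∈ range (L - i), x ^ u +
        (x + 1) * x ^ (h + 1 + (d + (jl - m - d) / 2 + h - 1)) * ∑ i ∈ range ((2 * m + 1 - d) / 2 - h), x ^ i -
      (A0M + (x + 1) * x ^ d * ∑ i ∈ range h, x ^ (2 * i))) =
      (x - 1) * (A0P - A0M) + (x - 1) * ((x + 1) * x ^ (d - 1) * ∑ u ∈ range (L + 1), x ^ u) +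
        (x - 1) * ∑ i ∈ range h, (x ^ 2 - 1) * x ^ (2 * i + d) * ∑ u ∈ range (L - i), x ^ u +
        (x - 1) * ((x + 1) * x ^ (h + 1 + (d + (jl - m - d) / 2 + h - 1)) * ∑ i ∈ range ((2 * m + 1 - d) / 2 - h), x ^ i) -
      (x - 1) * ((x + 1) * x ^ d * ∑ i ∈ range h, x ^ (2 * i)) by ring,
    hA0, t1, t2, t3, t4, t5]
  -- atoms `x^L`, `x^h`, `x^p` (`p = S∕2 − 1`), `x`, per parity of `d`
  rcases Nat.mod_two_eq_zero_or_one d with hδ | hδ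
  · have f1 : x ^ (d - 1) = x ^ p * x ^ p * x := by rw [← pow_add, ← pow_succ]; congr 1; omega
    have f2 : x ^ d = x ^ p * x ^ p * x * x := by rw [← pow_add, ← pow_succ, ← pow_succ]; congr 1; omega
    have f3 : x ^ (2 * h) = x ^ h * x ^ h := by rw [← pow_add]; congr 1; omega
    have f4 : x ^ (h + 1 + (d + (jl - m - d) / 2 + h - 1)) = x ^ h * x ^ p * x ^ p * x ^ L * x * x := by
      rw [← pow_add, ← pow_add, ← pow_add, ← pow_succ, ← pow_succ]; congr 1; omega
    have f5 : x ^ h * x ^ p * x ^ p * x ^ L * x * x * x ^ ((2 * m + 1 - d) / 2 - h) = x ^ h * x ^ h * x ^ L * x ^ p * x := by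
      rw [← pow_add, ← pow_add, ← pow_add, ← pow_succ, ← pow_succ, ← pow_add, ← pow_add, ← pow_add, ← pow_add, ← pow_succ]; congr 1; omega
    have f6 : x ^ m = x ^ h * x ^ h := by rw [← pow_add]; congr 1; omega
    have f7 : x ^ (jl / 2) = x ^ L * x ^ p * x := by rw [← pow_add, ← pow_succ]; congr 1; omega
    have f8 : x ^ (d - d % 2) = x ^ p * x ^ p * x * x := by rw [← pow_add, ← pow_succ, ← pow_succ]; congr 1; omega
    rw [f4, f5, f1, f2, f3, f6, f7, f8]; ring
  · have f1 : x ^ (d - 1) = x ^ p * x ^ p * x * x := by rw [← pow_add, ← pow_succ, ← pow_succ]; congr 1; omega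
    have f2 : x ^ d = x ^ p * x ^ p * x * x * x := by rw [← pow_add, ← pow_succ, ← pow_succ, ← pow_succ]; congr 1; omega
    have f3 : x ^ (2 * h) = x ^ h * x ^ h := by rw [← pow_add]; congr 1; omega
    have f4 : x ^ (h + 1 + (d + (jl - m - d) / 2 + h - 1)) = x ^ h * x ^ p * x ^ p * x ^ L * x * x * x := by
      rw [← pow_add, ← pow_add, ← pow_add, ← pow_succ, ← pow_succ, ← pow_succ]; congr 1; omega
    have f5 : x ^ h * x ^ p * x ^ p * x ^ L * x * x * x * x ^ ((2 * m + 1 - d) / 2 - h) = x ^ h * x ^ h * x ^ L * x ^ p * x * x * x := by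
      rw [← pow_add, ← pow_add, ← pow_add, ← pow_succ, ← pow_succ, ← pow_succ, ← pow_add, ← pow_add, ← pow_add, ← pow_add, ← pow_succ, ← pow_succ, ← pow_succ]
      congr 1; omega
    have f6 : x ^ m = x ^ h * x ^ h * x := by rw [← pow_add, ← pow_succ]; congr 1; omega
    have f7 : x ^ (jl / 2) = x ^ L * x ^ p * x * x := by rw [← pow_add, ← pow_succ, ← pow_succ]; congr 1; omega
    have f8 : x ^ (d - d % 2) = x ^ p * x ^ p * x * x := by rw [← pow_add, ← pow_succ, ← pow_succ]; congr 1; omega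
    rw [f4, f5, f1, f2, f3, f6, f7, f8]; ring

/-- THE ARITHMETIC, `ε = −1` branch (`m = jl − d + 1`, `S − 1 ≤ m`): the `+` side has no diagonal, the `−` side is all diagonal up to `j ≤ jl − S∕2`; same collapse. [folklore] -/
theorem algebra_neg_v5 (x : ℚ) (hx1 : x ≠ 1) {d jl m : ℕ} (hd : 2 ≤ d) (hdjl : d ≤ jl) (hm : m = jl - d + 1) (hmS : d - d % 2 ≤ m + 1) (hjl : jl % 2 = 0)
    (A0P A0M : ℚ) (hA0 : A0P - A0M = -x ^ (d - 1)) :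
    (-1) * ((A0P + (x + 1) * x ^ (d - 1) * ∑ u ∈ range ((jl - d) / 2 + 1), x ^ u +
        ∑ i ∈ range (min (m / 2) ((jl - d) / 2)), (x ^ 2 - 1) * x ^ (2 * i + d) * ∑ u ∈ range ((jl - d) / 2 - i), x ^ u + 0) -
      (A0M + (x + 1) * x ^ d * ∑ i ∈ range (m / 2), x ^ (2 * i) +
        (x + 1) * x ^ (d + m - 1) * ∑ i ∈ range ((2 * jl + 1 - d) / 2 + 1 - (d + m / 2)), x ^ i)) =
      x ^ m * ((1 + (x + 1) * ∑ i ∈ range (jl / 2), x ^ i) - 2 * ∑ i ∈ range (d - d % 2), x ^ i) := by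
  set L := (jl - d) / 2 with hL
  set p := (d - d % 2) / 2 - 1 with hp
  rw [min_eq_right (by omega : L ≤ m / 2), add_zero]
  apply mul_left_cancel₀ (sub_ne_zero.2 hx1)
  have t1 : (x - 1) * ((x + 1) * x ^ (d - 1) * ∑ u ∈ range (L + 1), x ^ u) = (x + 1) * x ^ (d - 1) * (x ^ L * x - 1) := by
    rw [show (x - 1) * ((x + 1) * x ^ (d - 1) * ∑ u ∈ range (L + 1), x ^ u) = (x + 1) * x ^ (d - 1) * ((x - 1) * ∑ u ∈ range (L + 1), x ^ u) by ring,
      geom_sum_mul', pow_succ]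
  have t2 := low_block_mul x (d := d) (L := L) (h := L) (by omega) le_rfl
  have t4 : (x - 1) * ((x + 1) * x ^ d * ∑ i ∈ range (m / 2), x ^ (2 * i)) = x ^ d * (x ^ (2 * (m / 2)) - 1) := by
    rw [show (x - 1) * ((x + 1) * x ^ d * ∑ i ∈ range (m / 2), x ^ (2 * i)) = x ^ d * ((x ^ 2 - 1) * ∑ i ∈ range (m / 2), x ^ (2 * i)) by ring, geom_sum_two_mul]
  have t6 : (x - 1) * ((x + 1) * x ^ (d + m - 1) * ∑ i ∈ range ((2 * jl + 1 - d) / 2 + 1 - (d + m / 2)), x ^ i) =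
      (x + 1) * (x ^ (d + m - 1) * x ^ ((2 * jl + 1 - d) / 2 + 1 - (d + m / 2)) - x ^ (d + m - 1)) := by
    rw [show (x - 1) * ((x + 1) * x ^ (d + m - 1) * ∑ i ∈ range ((2 * jl + 1 - d) / 2 + 1 - (d + m / 2)), x ^ i) =
      (x + 1) * x ^ (d + m - 1) * ((x - 1) * ∑ i ∈ range ((2 * jl + 1 - d) / 2 + 1 - (d + m / 2)), x ^ i) by ring, geom_sum_mul']
    ring
  have t5 : (x - 1) * (x ^ m * ((1 + (x + 1) * ∑ i ∈ range (jl / 2), x ^ i) - 2 * ∑ i ∈ range (d - d % 2), x ^ i)) =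
      x ^ m * ((x - 1) + (x + 1) * (x ^ (jl / 2) - 1) - 2 * (x ^ (d - d % 2) - 1)) := by
    rw [show (x - 1) * (x ^ m * ((1 + (x + 1) * ∑ i ∈ range (jl / 2), x ^ i) - 2 * ∑ i ∈ range (d - d % 2), x ^ i)) =
      x ^ m * ((x - 1) + (x + 1) * ((x - 1) * ∑ i ∈ range (jl / 2), x ^ i) - 2 * ((x - 1) * ∑ i ∈ range (d - d % 2), x ^ i)) by ring,
      geom_sum_mul', geom_sum_mul']
  rw [show (x - 1) * ((-1) * ((A0P + (x + 1) * x ^ (d - 1) * ∑ u ∈ range (L + 1), x ^ u +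
        ∑ i ∈ range L, (x ^ 2 - 1) * x ^ (2 * i + d) * ∑ u ∈ range (L - i), x ^ u) -
      (A0M + (x + 1) * x ^ d * ∑ i ∈ range (m / 2), x ^ (2 * i) +
        (x + 1) * x ^ (d + m - 1) * ∑ i ∈ range ((2 * jl + 1 - d) / 2 + 1 - (d + m / 2)), x ^ i))) =
      -((x - 1) * (A0P - A0M) + (x - 1) * ((x + 1) * x ^ (d - 1) * ∑ u ∈ range (L + 1), x ^ u) +
        (x - 1) * ∑ i ∈ range L, (x ^ 2 - 1) * x ^ (2 * i + d) * ∑ u ∈ range (L - i), x ^ u -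
        (x - 1) * ((x + 1) * x ^ d * ∑ i ∈ range (m / 2), x ^ (2 * i)) -
        (x - 1) * ((x + 1) * x ^ (d + m - 1) * ∑ i ∈ range ((2 * jl + 1 - d) / 2 + 1 - (d + m / 2)), x ^ i)) by ring,
    hA0, t1, t2, t4, t6, t5]
  rcases Nat.mod_two_eq_zero_or_one d with hδ | hδ
  · -- `d` even: `jl − d = 2L`, `m = 2L + 1`, `⌊m∕2⌋ = L`
    have f1 : x ^ (d - 1) = x ^ p * x ^ p * x := by rw [← pow_add, ← pow_succ]; congr 1; omega
    have f2 : x ^ d = x ^ p * x ^ p * x * x := by rw [← pow_add, ← pow_succ, ← pow_succ]; congr 1; omega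
    have f3 : x ^ (2 * (m / 2)) = x ^ L * x ^ L := by rw [← pow_add]; congr 1; omega
    have f4 : x ^ (d + m - 1) = x ^ L * x ^ L * x ^ p * x ^ p * x * x := by rw [← pow_add, ← pow_add, ← pow_add, ← pow_succ, ← pow_succ]; congr 1; omega
    have f5 : x ^ L * x ^ L * x ^ p * x ^ p * x * x * x ^ ((2 * jl + 1 - d) / 2 + 1 - (d + m / 2)) = x ^ L * x ^ L * x ^ L * x ^ p * x * x := by
      simp only [← pow_succ, ← pow_add]; congr 1; omega
    have f6 : x ^ m = x ^ L * x ^ L * x := by rw [← pow_add, ← pow_succ]; congr 1; omega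
    have f7 : x ^ (jl / 2) = x ^ L * x ^ p * x := by rw [← pow_add, ← pow_succ]; congr 1; omega
    have f8 : x ^ (d - d % 2) = x ^ p * x ^ p * x * x := by rw [← pow_add, ← pow_succ, ← pow_succ]; congr 1; omega
    rw [f4, f5, f1, f2, f3, f6, f7, f8]; ring
  · -- `d` odd: `jl − d = 2L + 1`, `m = 2L + 2`, `⌊m∕2⌋ = L + 1`
    have f1 : x ^ (d - 1) = x ^ p * x ^ p * x * x := by rw [← pow_add, ← pow_succ, ← pow_succ]; congr 1; omega
    have f2 : x ^ d = x ^ p * x ^ p * x * x * x := by rw [← pow_add, ← pow_succ, ← pow_succ, ← pow_succ]; congr 1; omega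
    have f3 : x ^ (2 * (m / 2)) = x ^ L * x ^ L * x * x := by rw [← pow_add, ← pow_succ, ← pow_succ]; congr 1; omega
    have f4 : x ^ (d + m - 1) = x ^ L * x ^ L * x ^ p * x ^ p * x * x * x * x := by
      rw [← pow_add, ← pow_add, ← pow_add, ← pow_succ, ← pow_succ, ← pow_succ, ← pow_succ]; congr 1; omega
    have f5 : x ^ L * x ^ L * x ^ p * x ^ p * x * x * x * x * x ^ ((2 * jl + 1 - d) / 2 + 1 - (d + m / 2)) = x ^ L * x ^ L * x ^ L * x ^ p * x * x * x * x := by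
      simp only [← pow_succ, ← pow_add]; congr 1; omega
    have f6 : x ^ m = x ^ L * x ^ L * x * x := by rw [← pow_add, ← pow_succ, ← pow_succ]; congr 1; omega
    have f7 : x ^ (jl / 2) = x ^ L * x ^ p * x * x := by rw [← pow_add, ← pow_succ, ← pow_succ]; congr 1; omega
    have f8 : x ^ (d - d % 2) = x ^ p * x ^ p * x * x := by rw [← pow_add, ← pow_succ, ← pow_succ]; congr 1; omega
    rw [f4, f5, f1, f2, f3, f6, f7, f8]; ring


/-- **O-SUM ∕ T5s, TYPE U («K∕F UNRAMIFIED») — THE TORIC CENSUS SUM.**  Let `nP nM : ℕ → ℕ → ℚ` follow the u-FREE LEVEL TABLES of type U (E1 v1 §B ∕ T5a v2 §2: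
`+` side `n₊(j,a) = (q²−1)q^{(j+a+d)∕2−2}` on `1 ≤ a ≤ j − d`, `a ≡ j − d (2)`, `n₊(j,0) = (q+1)q^{(j+d)∕2−1}` (`j ≥ d`) ∕ `G j` (`j < d`) for `j ≡ d (2)`; `−` side `n₋ = G j` on
`a = j + 1 − d` (`j ≥ d − 1`) and on `a = 0`, `j ≤ d − 2`, `j + d` odd; `G j = |(𝒪_M∕ϖ^j)^×∕(𝒪_E∕ϖ^j)^×| = (q+1)q^{j−1}`, `G 0 = 1`) and let `vP vM` follow the DEPTH RULES at the tokens
`(m, ε)` (E1 v1 §C ∕ T5a v2 §2b: column `a = 0` all; off the diagonal `j − a = jl − m` the LOW cells `2a ≤ m ∧ (j + a ≤ m ∨ j + a ≤ jl)`; on it the LOW cells all and the TOP cells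
`χ·n∕φ`, `φ₊ = (q−1)q^{⌈(2a−m)∕2⌉−1}`, `φ₋ = q^{⌊(2a−m)∕2⌋}`, `χ_s = [s is the side of ε]` below `jl` and `0` at `j = jl`).  Then on the REALIZABLE token set
`{ε = +1, m ≡ d (2), 1 ≤ m ≤ jl − d} ∪ {ε = −1, m = jl − d + 1}` (`jl` even, `d ≥ 2`):
`ε·Σ_{j ≤ jl} Σ_{a} q^a (vP j a − vM j a) = q^m·(N_V − 2[S]_q)`, `N_V = 1 + (q+1)[jl∕2]_q` (H-LEVEL BINDER `2n_H = jl`, p08 §3 ∕ r01), `S = d − d%2`, under the token fact `S − 1 ≤ m` — the O-Sum organ of the (ρ2b′-X) payer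
(`stub_U2H_fixedPointCensus_typeTwo_unit0`), type U.  Pure finite-sum bookkeeping over `ℚ` (no lattices): the `+` columns are geometric blocks on the parity rays `j = a + d + 2u`
plus the TOP diagonal `(q+1)q^{a+jl∕2+S∕2−1}` (`⌊m∕2⌋ < a ≤ m − S∕2`), the `−` side one cell per row (TOP up to `j ≤ jl − S∕2`), `A0₊^{<d} − A0₋ = −q^{d−1}`, and the three `(q+1)`-blocks
telescope.  Statement validated `validate_head.v3` (Lean ℕ-semantics): hreal ∩ {S − 1 ≤ m}, 524∕524 tuples.  Supersedes ★ `…ToricCensusSumUnr.toricCensusSum_unr` (sheet v3 letters, S = 2 shadow).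
[cite: Kottwitz1986BaseChangeUnits, §1 pp. 240–241] [cite: Rogawski1990, §4.9 Prop. 4.9.1 (b) p. 55, Lemma 4.9.3 p. 56] -/
theorem toricCensusSum_unr_v5 (q : ℕ) {d jl m : ℕ} (ε : ℚ) (hq : 2 ≤ q) (hd : 2 ≤ d) (hjl : jl % 2 = 0) (hmS : d - d % 2 ≤ m + 1)
    (hreal : (ε = 1 ∧ m % 2 = d % 2 ∧ 1 ≤ m ∧ m + d ≤ jl) ∨ (ε = -1 ∧ m = jl - d + 1 ∧ d ≤ jl))
    (nP nM vP vM : ℕ → ℕ → ℚ)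
    (hnP : ∀ j a, 1 ≤ a → nP j a = if a + d ≤ j ∧ (j - a - d) % 2 = 0 then ((q : ℚ) ^ 2 - 1) * (q : ℚ) ^ (j - 2 - (j - a - d) / 2) else 0)
    (hnP0 : ∀ j, nP j 0 = if (j + d) % 2 = 0 then (if d ≤ j then ((q : ℚ) + 1) * (q : ℚ) ^ ((j + d) / 2 - 1) else (if j = 0 then 1 else ((q : ℚ) + 1) * (q : ℚ) ^ (j - 1))) else 0)
    (hnM : ∀ j a, nM j a = if (d ≤ j + 1 ∧ a + d = j + 1) ∨ (j + 1 < d ∧ a = 0 ∧ (j + d) % 2 = 1) then (if j = 0 then 1 else ((q : ℚ) + 1) * (q : ℚ) ^ (j - 1)) else 0)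
    (hv0 : ∀ j, vP j 0 = nP j 0 ∧ vM j 0 = nM j 0)
    (hvOff : ∀ j a, 1 ≤ a → j + m ≠ jl + a →
      (vP j a = if 2 * a ≤ m ∧ (j + a ≤ m ∨ j + a ≤ jl) then nP j a else 0) ∧ (vM j a = if 2 * a ≤ m ∧ (j + a ≤ m ∨ j + a ≤ jl) then nM j a else 0))
    (hvLow : ∀ j a, 1 ≤ a → j + m = jl + a → 2 * a ≤ m → vP j a = nP j a ∧ vM j a = nM j a)
    (hvTopP : ∀ j a, 1 ≤ a → j + m = jl + a → m < 2 * a →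
      vP j a = if (d + m ≤ jl ∧ (jl - d - m) % 2 = 0) ∧ 2 * j + d ≤ 2 * jl + 1 then nP j a / (((q : ℚ) - 1) * (q : ℚ) ^ ((2 * a - m + 1) / 2 - 1)) else 0)
    (hvTopM : ∀ j a, 1 ≤ a → j + m = jl + a → m < 2 * a →
      vM j a = if jl + 1 = d + m ∧ 2 * j + d ≤ 2 * jl + 1 then nM j a / (q : ℚ) ^ ((2 * a - m) / 2) else 0) :
    ε * ∑ j ∈ range (jl + 1), ∑ a ∈ range (jl + 2), (q : ℚ) ^ a * (vP j a - vM j a) =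
      (q : ℚ) ^ m * ((1 + ((q : ℚ) + 1) * ∑ i ∈ range (jl / 2), (q : ℚ) ^ i) - 2 * ∑ i ∈ range (d - d % 2), (q : ℚ) ^ i) := by
  have hx0 : (q : ℚ) ≠ 0 := Nat.cast_ne_zero.2 (by omega)
  have hx1 : (q : ℚ) ≠ 1 := by exact_mod_cast (show q ≠ 1 by omega)
  -- the rows below the conductor: `A0₊^{<d} − A0₋ = −q^{d−1}`
  have hA0 : ∑ j ∈ range d, (if j % 2 = d % 2 then (if j = 0 then (1 : ℚ) else ((q : ℚ) + 1) * (q : ℚ) ^ (j - 1)) else 0) -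
      ∑ j ∈ range d, (if j % 2 ≠ d % 2 then (if j = 0 then (1 : ℚ) else ((q : ℚ) + 1) * (q : ℚ) ^ (j - 1)) else 0) = -(q : ℚ) ^ (d - 1) := by
    rw [← Finset.sum_sub_distrib, ← alt_index_sum (q : ℚ) (by omega : 1 ≤ d)]
    refine Finset.sum_congr rfl fun j _ => ?_
    by_cases h : j % 2 = d % 2
    · rw [if_pos h, if_neg (not_not.2 h), if_pos h]; ring
    · rw [if_neg h, if_pos h, if_neg h]; ring
  have hsplit : ∑ j ∈ range (jl + 1), ∑ a ∈ range (jl + 2), (q : ℚ) ^ a * (vP j a - vM j a) =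
      ∑ j ∈ range (jl + 1), ∑ a ∈ range (jl + 2), (q : ℚ) ^ a * vP j a - ∑ j ∈ range (jl + 1), ∑ a ∈ range (jl + 2), (q : ℚ) ^ a * vM j a := by
    rw [← Finset.sum_sub_distrib]
    refine Finset.sum_congr rfl fun j _ => ?_
    rw [← Finset.sum_sub_distrib]
    refine Finset.sum_congr rfl fun a _ => ?_
    ring
  rw [hsplit]
  rcases hreal with ⟨hε, hpar, hm1, hmd⟩ | ⟨hε, hmeq, hdjl⟩
  · subst hε
    rw [sumP_eval_v5 (q : ℚ) hx0 hx1 hd (by omega) (by omega) nP vP hnP hnP0 (fun j => (hv0 j).1) (fun j a ha hne => (hvOff j a ha hne).1)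
        (fun j a ha he hl => (hvLow j a ha he hl).1) hvTopP,
      sumM_eval_v5 (q : ℚ) hx0 hd (by omega) (by omega) nM vM hnM (fun j => (hv0 j).2) (fun j a ha hne => (hvOff j a ha hne).2)
        (fun j a ha he hl => (hvLow j a ha he hl).2) hvTopM,
      if_pos (show m + d ≤ jl ∧ (jl - m - d) % 2 = 0 from ⟨hmd, by omega⟩),
      if_neg (show ¬ (jl + 1 = d + m) from by omega),
      min_eq_left (by omega : m / 2 ≤ (jl - d) / 2), one_mul, add_zero]
    exact algebra_pos_v5 (q : ℚ) hx1 hd hpar hmS hmd hjl _ _ hA0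
  · subst hε
    rw [sumP_eval_v5 (q : ℚ) hx0 hx1 hd (by omega) (by omega) nP vP hnP hnP0 (fun j => (hv0 j).1) (fun j a ha hne => (hvOff j a ha hne).1)
        (fun j a ha he hl => (hvLow j a ha he hl).1) hvTopP,
      sumM_eval_v5 (q : ℚ) hx0 hd (by omega) (by omega) nM vM hnM (fun j => (hv0 j).2) (fun j a ha hne => (hvOff j a ha hne).2)
        (fun j a ha he hl => (hvLow j a ha he hl).2) hvTopM,
      if_neg (show ¬ (m + d ≤ jl ∧ (jl - m - d) % 2 = 0) from fun h => by omega),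
      if_pos (show jl + 1 = d + m from by omega)]
    exact algebra_neg_v5 (q : ℚ) hx1 hd hdjl hmeq hmS hjl _ _ hA0

end Summit.HodgeConjecture.HodgeConjecture.Cruxes.H413.F0P3cDyRamToricCensusSumUnrV5
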